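import Summits.QuantumFields.YangMills.Theorems.BalabanUVNodesN22AtRecordOfDichotomyLetter
import Summits.QuantumFields.YangMills.Theorems.BalabanUVNodesN22WindowedNE9OutputLevel

/-!
# NODE N22 (NE9) — K3⁷ v5 §2b's `h9` and the N22 pin face AT THE RECORD FROM PRINT-LEVEL INPUTS: OUTPUT-level coordinatewise coupling letters ∕ holomorphy of the (2.13)
# terms ([I] p. 263 ∕ p. 266 quantified), term holomorphy through the complexified readings, p. 282 tails — «J34-at-record»

Cell `pub-ymgap`, Track A (HUMAN RULING D-0062), WIDTH SEAT `dag-n22-w5` (g0) on node n22 = NE9, D-0154 (3a) second width wave; `--kind proof --supports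
stmt-QuantumFields-20544 --as helper` (K3⁷ `SpineGivenEndpointR13SepCoPH`, skeleton v5 941dddb108cbaacf), COUNT-NEUTRAL; THEOREMS ONLY (0 `def`, 0 `sorry`, standard axioms).
dag-n22-c g13's hand «J34-at-record = one application of your §1 `ne9_EA_objectsOfRecord₁₃_of_windowedLetter` — yours if wanted» (pub-ymgap INBOX 2026-08-28T07:45:41Z ∕ 07:46:18Z;
CLAIM-4 ∕ INTENT-5 on the bus).  J34 = dag-n22-c g13's `…N22WindowedNE9OutputLevel` (p613551): the (β′) letter `WindowedNE9 F (localizedSum F S emb) …` from OUTPUT-level inputs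
only — NO activity-level slot, NO (2.38), NO Road-1 numerals.  Here it is read AT THE RECORD through `…N22AtRecordOfDichotomyLetter` §1 (this seat, p613896).  Nothing of
J34 ∕ W1-19b ∕ p593053 is re-declared; every step is plain application.

WHAT.  ★★★ `ne9_EA_objectsOfRecord₁₃_of_outputCoordLetters` ∕ ★★★ `n22At_rateCarriers_of_kernels_pin_of_outputCoordLetters` — towers `S K : ClusterTower (F.P K) 𝔸 M` (`M = L^{m′}`;
configuration type `𝔸` instance-FREE) read through `emb : ReadingMaps F (MatA N) 𝔸` with W1-20's law `Localizes17OfRecord₁₃ F N θ S emb`; per `(K, k)` the (2.13) terms carry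
per-coordinate OUTPUT-level coupling-Lipschitz letters `‖E^{(k+1)}(X; g; φ) − E^{(k+1)}(X; g|g_i := t; φ)‖ ≤ Λt (k+1) i·e^{−κ d_{k+1}(X)}·|g_i − t|` on the boxes `W1.box θ.γ k` and
configurations `φ ∈ sp K k X` ([I] p. 263 ∕ p. 266 quantified; older couplings N10 ∕ NODE A, last coupling N09 — DISPLAYED); per `(K, k, X)` a complexified probe reading `Φ K k X`
of the record's β-chart on an open `U K k X ⊇ ball 0 r` extending `emb K k ∘ exp θ.ρ8`, mapping the ball into `sp K k X`, with the TERM `z ↦ E^{(k+1)}(X; histPrefix g k; Φ K k X z)`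
holomorphic for every window history; site weights with the minimizer tails ([I] p. 282); `2κ₀(64,8) ≤ κ`, `δ₀ > 0`; the (1.21) existence `PolLimitsExistOfRecord₁₃ F N θ`; a letter
block `ℓ` with its signs DOMINATING `ℓ.κ ≤ δ₁`, `C·Λt ≤ ℓ.moduli` (`C = (16B₃²∕r²)·exp(12Mδ₁)·K₀(64,8)·K₁(4,δ₀∕2)`) ⟹ `NE9 ((objectsOfRecord₁₃ F N θ ℓ).EA 0) (Window θ.γ) ℓ.κ ℓ.moduli`
(= K3⁷ v5 §2b's `h9`) and, under `hpin`, `N22At (rateCarriersOfRecord₁₃CoPH 𝔯 F θ hP g₀ os k).u3` for EVERY `k`.  ★★★ `ne9_EA_objectsOfRecord₁₃_of_outputCoordHolo` ∕ ★★★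
`n22At_rateCarriers_of_kernels_pin_of_outputCoordHolo` — the same with the letters DISCHARGED (J34 §2) from OUTPUT-level coupling HOLOMORPHY on uniform margins in every
coupling: a holomorphic extension of `t ↦ E^{(k+1)}(X; g|g_i := t; φ)` to a set containing the closed `ρt (k+1) i`-discs about `]0, θ.γ]`, bounded by `B·e^{−κ_E d_{k+1}(X)}`,
`κ ≤ κ_E` ([I] p. 266 «𝐄^{(j)} … analytic functions of the effective coupling constants» READ QUANTITATIVELY at complexified configurations); moduli `C·4B∕ρt n i`.
THE N22 ROW SENTENCE AT (β), PRINT-LEVEL CURRENCY: «W1-20's law + output-level coupling letters (or margins) of the (2.13) terms + term holomorphy through the complexified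
readings + p. 282 tails + (1.21) existence + a dominating letter block ⇒ v5 §2b `h9` ∕ `N22At` at the pinned bundle, every run length».  A5∕A6: J34 `outputCoordLetters_termlessStep`
inhabits the term-side hypotheses at the termless step (DEGENERATE, declared); the law, `PolLimitsExistOfRecord₁₃`, `θ` and the reading OF RECORD are LOCATED hypotheses.

HONEST FRAMING (binding).  Count-neutral COMPOSITION of landed theorems by name; NO estimate of Bałaban's is proved or asserted; every displayed input is a HYPOTHESIS with its
owner (output-level coupling letters ∕ margins: N10 ∕ NODE A for the older couplings, N09 `EHoloAt` for the last; term holomorphy through the readings + tails: NODE A ∕ N09; law: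
NODE A ∕ N10; (1.21): dag-n22-w3's road); the uniform last-coupling margin is the cell's quantified reading, NOT a printed estimate (print: [I] p. 263 «C^∞ (or analytic)»);
nothing of the record is constructed or claimed to meet them; N22 is NOT discharged (typed 28∕28 · discharged 5∕27 UNCHANGED); K3⁷ OPEN and NOT claimed; NE9 is NOT IN PRINT
for d = 4; no count claim (the chair's single count line is the only count); no summit statement is proved by this seat; one finite 𝕋⁴ programme at fixed ε — R4 closes the
CONDITIONAL rung `BalabanLadder.UV` only; NOTHING about the continuum limit, ℝ⁴, infinite volume, OS axioms, a mass gap or the Clay problem is proved or claimed by any of this.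
References (TYPES only): [I] = Bałaban, CMP 109 (1987) (1.7) p. 261, §1 p. 263, §2 p. 266, (1.18) p. 263, (1.20)–(1.21) p. 264, p. 282; [II] = CMP 116 (1988) (2.13) p. 14, p. 15.
-/

noncomputable section

open Filter Topology Metric Set
open scoped BigOperators

namespace YMDAG.N22.AtRecordOfPrintedSlots

open Literature.MathematicalPhysics.QuantumFieldTheory.Balaban1983to89
open Literature.MathematicalPhysics.QuantumFieldTheory.Balaban1983to89.T4Continuum (T4Family ULoop)
open Literature.MathematicalPhysics.QuantumFieldTheory.Balaban1983to89.T4OutputRate (Window NE9)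
open Literature.MathematicalPhysics.QuantumFieldTheory.Balaban1983to89.Node00 (Stage13Params Stage13HParams U3Letters₁₁ MatA)
open Literature.MathematicalPhysics.QuantumFieldTheory.Balaban1983to89.Node00.Sect2 (domCount domSys CPair)
open Literature.MathematicalPhysics.QuantumFieldTheory.Balaban1983to89.Node00.LocalizedSum17 (localizedSum ReadingMaps Localizes17OfRecord₁₃)
open Literature.MathematicalPhysics.QuantumFieldTheory.Balaban1983to89.Node00.W1 (ClusterTower ClusterStep box)
open Literature.MathematicalPhysics.QuantumFieldTheory.Balaban1983to89.Node00.U3OfKernels (histPrefix objectsOfRecord₁₃)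
open Literature.MathematicalPhysics.QuantumFieldTheory.Balaban1983to89.Node00.U3KernelLetters (PolLimitsExistOfRecord₁₃)
open Literature.MathematicalPhysics.QuantumFieldTheory.Balaban1983to89.B12Decay510 (delta1)
open Literature.MathematicalPhysics.QuantumFieldTheory.Balaban1983to89.B12Decay510Window (K₁)
open Literature.MathematicalPhysics.QuantumFieldTheory.Balaban1983to89.B12Decay510Torus (distCT nearT)
open Literature.MathematicalPhysics.QuantumFieldTheory.Balaban1983to89.B12TreeDecay (K₀ kappa₀)
open Literature.MathematicalPhysics.QuantumFieldTheory.Balaban1983to89.TreeLengthTorus (TPt)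
open YMDAG.UVSplit (N22At RateReading₁₃CoPH rateCarriersOfRecord₁₃CoPH)
open YMDAG.N22.AtKernels (n22At_rateCarriers_of_kernels_pin_of_ne9)
open YMDAG.N22.OutputLevel (windowedNE9_localizedSum_of_outputCoordLetters windowedNE9_localizedSum_of_outputCoordHolo)

open scoped Matrix.Norms.L2Operator

variable (F : T4Family) (N : ℕ) [NeZero N]

/-! ## §1 `h9` from OUTPUT-level coupling letters ∕ holomorphy of the (2.13) terms -/

open Classical in
/-- ★★★ **K3⁷ v5 §2b's `h9` FROM OUTPUT-LEVEL COUPLING LETTERS OF THE (2.13) TERMS** (J34 at the record): law `Localizes17OfRecord₁₃ F N θ S emb` + per-coordinate output-level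
coupling-Lipschitz letters `hlet` on the boxes (moduli `Λt ≥ 0`, rate `κ`) + term holomorphy `hEhol` through the complexified readings of the record's β-chart (chart∕space clauses) +
site weights with tails + `2κ₀(64,8) ≤ κ`, `δ₀ > 0` + `PolLimitsExistOfRecord₁₃ F N θ` + a dominating letter block ⟹ `NE9 ((objectsOfRecord₁₃ F N θ ℓ).EA 0) (Window θ.γ) ℓ.κ ℓ.moduli` —
J34 `windowedNE9_localizedSum_of_outputCoordLetters` at `W := Window θ.γ` ∘ `ne9_EA_objectsOfRecord₁₃_of_windowedLetter`.  NO activity-level hypothesis.  LOCATED; N22 NOT discharged. -/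
theorem ne9_EA_objectsOfRecord₁₃_of_outputCoordLetters (θ : Stage13Params F N) (ℓ : U3Letters₁₁) (hs : ℓ.Signs) (hlim : PolLimitsExistOfRecord₁₃ F N θ)
    {𝔸 : Type*} (m' : ℕ) (M : ℕ) [NeZero M] (hM : M = F.L ^ m')
    (S : (K : ℕ) → ClusterTower (F.P K) 𝔸 M) (emb : ReadingMaps F (MatA N) 𝔸) (hloc : Localizes17OfRecord₁₃ F N θ S emb)
    (sp : (K k : ℕ) → (domSys (F.P K) M (k + 1)).Dom → Set (CPair (F.P K) 𝔸))
    {κ δ₀ B₃ r : ℝ} (Λt : ℕ → ℕ → ℝ) (hΛt : ∀ n i, 0 ≤ Λt n i)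
    (hκ₀ : kappa₀ (4 * 2 ^ 4) (2 * 4) ≤ κ / 2) (hδ₀ : 0 < δ₀) (hB₃ : 0 ≤ B₃) (hr : 0 < r)
    (hlet : ∀ (K k : ℕ), ∀ g ∈ box θ.γ k, ∀ (i : Fin (k + 1)), ∀ t ∈ Ioc (0 : ℝ) θ.γ, ∀ (X : (domSys (F.P K) M (k + 1)).Dom), ∀ φ ∈ sp K k X,
      ‖((S K) k).E g φ X - ((S K) k).E (Function.update g i t) φ X‖ ≤ Λt (k + 1) i * Real.exp (-(κ * (domSys (F.P K) M (k + 1)).dj X)) * |g i - t|)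
    (Ec : ℕ → ℕ → Type*) [∀ K k, NormedAddCommGroup (Ec K k)] [∀ K k, NormedSpace ℂ (Ec K k)]
    (ι : letI := θ.instVβ₁; letI := θ.instVβ₂
      (K k : ℕ) → (domSys (F.P K) M (k + 1)).Dom → ((Fin (F.P K).d → Site (F.P K) (k + 1) → θ.Vβ) →L[ℝ] Ec K k))
    (Φ : (K k : ℕ) → (domSys (F.P K) M (k + 1)).Dom → Ec K k → CPair (F.P K) 𝔸)
    (U : (K k : ℕ) → (domSys (F.P K) M (k + 1)).Dom → Set (Ec K k)) (hU : ∀ K k X, IsOpen (U K k X)) (hrU : ∀ K k X, ball (0 : Ec K k) r ⊆ U K k X)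
    (hEhol : ∀ g ∈ Window θ.γ, ∀ (K k : ℕ) (X : (domSys (F.P K) M (k + 1)).Dom),
      DifferentiableOn ℂ (fun z => ((S K) k).E (histPrefix g k) (Φ K k X z) X) (U K k X))
    (hΦemb : letI := θ.instVβ₁; letI := θ.instVβ₂
      ∀ (K k : ℕ) (X : (domSys (F.P K) M (k + 1)).Dom) (B : Fin (F.P K).d → Site (F.P K) (k + 1) → θ.Vβ),
        Φ K k X (ι K k X B) = emb K k (fun l t => NormedSpace.exp (θ.ρ8 (B l t))))
    (hΦsp : ∀ (K k : ℕ) (X : (domSys (F.P K) M (k + 1)).Dom), ∀ z ∈ ball (0 : Ec K k) r, Φ K k X z ∈ sp K k X)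
    (w : (K k : ℕ) → (domSys (F.P K) M (k + 1)).Dom → Site (F.P K) (k + 1) → ℝ) (hw₀ : ∀ K k X t, 0 ≤ w K k X t)
    (hw : letI := θ.instVβ₁; letI := θ.instVβ₂; letI := θ.instιβ
      ∀ (K k : ℕ) (X : (domSys (F.P K) M (k + 1)).Dom) (l : Fin (F.P K).d) (t : Site (F.P K) (k + 1)) (c : θ.ιβ),
        ‖ι K k X (Pi.single l (Pi.single t (θ.bV c)))‖ ≤ w K k X t)
    (htail : ∀ (K k : ℕ) (X : (domSys (F.P K) M (k + 1)).Dom) (t : Site (F.P K) (k + 1)),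
      let e : Site (F.P K) (k + 1) → TPt 4 (domCount (F.P K) M (k + 1) * M) := fun x i => (ZMod.cast (x i) : ZMod (domCount (F.P K) M (k + 1) * M))
      w K k X t ≤ B₃ * Real.exp (-δ₀ * distCT (domCount (F.P K) M (k + 1)) M (e t) (nearT (M := M) (e t) X)))
    (hℓκ : ℓ.κ ≤ delta1 δ₀ κ ((M : ℝ) * 4))
    (hdom : ∀ n i, 16 * B₃ ^ 2 / r ^ 2 * Real.exp (delta1 δ₀ κ ((M : ℝ) * 4) * ((M : ℝ) * 4) * 3) * K₀ (4 * 2 ^ 4) (2 * 4) * K₁ 4 (δ₀ / 2) * Λt n i ≤ ℓ.moduli n i) :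
    NE9 ((objectsOfRecord₁₃ F N θ ℓ).EA 0) (Window θ.γ) ℓ.κ ℓ.moduli := by
  letI := θ.instVβ₁; letI := θ.instVβ₂; letI := θ.instιβ
  exact ne9_EA_objectsOfRecord₁₃_of_windowedLetter F N θ ℓ hs hlim S emb hloc
    (windowedNE9_localizedSum_of_outputCoordLetters F m' M hM S emb θ.ρ8 θ.bV (Window θ.γ) subset_rfl sp Λt hΛt hκ₀ hδ₀ hB₃ hr hlet Ec ι Φ U hU hrU
      hEhol hΦemb hΦsp w hw₀ hw htail)
    hℓκ hdom

open Classical in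
/-- ★★★ **K3⁷ v5 §2b's `h9` FROM OUTPUT-LEVEL COUPLING HOLOMORPHY ON UNIFORM MARGINS IN EVERY COUPLING** (J34 §2 letters discharged): as
`ne9_EA_objectsOfRecord₁₃_of_outputCoordLetters` with the letters READ from one holomorphy datum `hL` per `(K, k, i)` (radii `ρt (k+1) i`, bound `B·e^{−κ_E d_{k+1}(X)}`, `κ ≤ κ_E`;
moduli `C·4B∕ρt n i`) — J34 `windowedNE9_localizedSum_of_outputCoordHolo` ∘ `ne9_EA_objectsOfRecord₁₃_of_windowedLetter`.  LOCATED (hypothesis form); N22 NOT discharged. -/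
theorem ne9_EA_objectsOfRecord₁₃_of_outputCoordHolo (θ : Stage13Params F N) (ℓ : U3Letters₁₁) (hs : ℓ.Signs) (hlim : PolLimitsExistOfRecord₁₃ F N θ)
    {𝔸 : Type*} (m' : ℕ) (M : ℕ) [NeZero M] (hM : M = F.L ^ m')
    (S : (K : ℕ) → ClusterTower (F.P K) 𝔸 M) (emb : ReadingMaps F (MatA N) 𝔸) (hloc : Localizes17OfRecord₁₃ F N θ S emb)
    (sp : (K k : ℕ) → (domSys (F.P K) M (k + 1)).Dom → Set (CPair (F.P K) 𝔸))
    {κ κE δ₀ B₃ r B : ℝ} (ρt : ℕ → ℕ → ℝ) (hρt : ∀ n i, 0 < ρt n i)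
    (hκ₀ : kappa₀ (4 * 2 ^ 4) (2 * 4) ≤ κ / 2) (hδ₀ : 0 < δ₀) (hB₃ : 0 ≤ B₃) (hr : 0 < r) (hB : 0 ≤ B) (hκE : κ ≤ κE)
    (hL : ∀ (K k : ℕ) (i : Fin (k + 1)), ∀ g ∈ box θ.γ k, ∀ (X : (domSys (F.P K) M (k + 1)).Dom), ∀ φ ∈ sp K k X,
      ∃ (Ec : ℂ → ℂ) (O : Set ℂ), DifferentiableOn ℂ Ec O ∧ (∀ t ∈ Ioc (0 : ℝ) θ.γ, closedBall (t : ℂ) (ρt (k + 1) i) ⊆ O) ∧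
        (∀ z ∈ O, ‖Ec z‖ ≤ B * Real.exp (-(κE * (domSys (F.P K) M (k + 1)).dj X))) ∧
        (∀ t ∈ Ioc (0 : ℝ) θ.γ, Ec t = ((S K) k).E (Function.update g i t) φ X))
    (Ec : ℕ → ℕ → Type*) [∀ K k, NormedAddCommGroup (Ec K k)] [∀ K k, NormedSpace ℂ (Ec K k)]
    (ι : letI := θ.instVβ₁; letI := θ.instVβ₂
      (K k : ℕ) → (domSys (F.P K) M (k + 1)).Dom → ((Fin (F.P K).d → Site (F.P K) (k + 1) → θ.Vβ) →L[ℝ] Ec K k))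
    (Φ : (K k : ℕ) → (domSys (F.P K) M (k + 1)).Dom → Ec K k → CPair (F.P K) 𝔸)
    (U : (K k : ℕ) → (domSys (F.P K) M (k + 1)).Dom → Set (Ec K k)) (hU : ∀ K k X, IsOpen (U K k X)) (hrU : ∀ K k X, ball (0 : Ec K k) r ⊆ U K k X)
    (hEhol : ∀ g ∈ Window θ.γ, ∀ (K k : ℕ) (X : (domSys (F.P K) M (k + 1)).Dom),
      DifferentiableOn ℂ (fun z => ((S K) k).E (histPrefix g k) (Φ K k X z) X) (U K k X))
    (hΦemb : letI := θ.instVβ₁; letI := θ.instVβ₂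
      ∀ (K k : ℕ) (X : (domSys (F.P K) M (k + 1)).Dom) (B : Fin (F.P K).d → Site (F.P K) (k + 1) → θ.Vβ),
        Φ K k X (ι K k X B) = emb K k (fun l t => NormedSpace.exp (θ.ρ8 (B l t))))
    (hΦsp : ∀ (K k : ℕ) (X : (domSys (F.P K) M (k + 1)).Dom), ∀ z ∈ ball (0 : Ec K k) r, Φ K k X z ∈ sp K k X)
    (w : (K k : ℕ) → (domSys (F.P K) M (k + 1)).Dom → Site (F.P K) (k + 1) → ℝ) (hw₀ : ∀ K k X t, 0 ≤ w K k X t)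
    (hw : letI := θ.instVβ₁; letI := θ.instVβ₂; letI := θ.instιβ
      ∀ (K k : ℕ) (X : (domSys (F.P K) M (k + 1)).Dom) (l : Fin (F.P K).d) (t : Site (F.P K) (k + 1)) (c : θ.ιβ),
        ‖ι K k X (Pi.single l (Pi.single t (θ.bV c)))‖ ≤ w K k X t)
    (htail : ∀ (K k : ℕ) (X : (domSys (F.P K) M (k + 1)).Dom) (t : Site (F.P K) (k + 1)),
      let e : Site (F.P K) (k + 1) → TPt 4 (domCount (F.P K) M (k + 1) * M) := fun x i => (ZMod.cast (x i) : ZMod (domCount (F.P K) M (k + 1) * M))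
      w K k X t ≤ B₃ * Real.exp (-δ₀ * distCT (domCount (F.P K) M (k + 1)) M (e t) (nearT (M := M) (e t) X)))
    (hℓκ : ℓ.κ ≤ delta1 δ₀ κ ((M : ℝ) * 4))
    (hdom : ∀ n i, 16 * B₃ ^ 2 / r ^ 2 * Real.exp (delta1 δ₀ κ ((M : ℝ) * 4) * ((M : ℝ) * 4) * 3) * K₀ (4 * 2 ^ 4) (2 * 4) * K₁ 4 (δ₀ / 2) *
        (4 * B / ρt n i) ≤ ℓ.moduli n i) :
    NE9 ((objectsOfRecord₁₃ F N θ ℓ).EA 0) (Window θ.γ) ℓ.κ ℓ.moduli := by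
  letI := θ.instVβ₁; letI := θ.instVβ₂; letI := θ.instιβ
  exact ne9_EA_objectsOfRecord₁₃_of_windowedLetter F N θ ℓ hs hlim S emb hloc
    (windowedNE9_localizedSum_of_outputCoordHolo F m' M hM S emb θ.ρ8 θ.bV (Window θ.γ) subset_rfl sp ρt hρt hκ₀ hδ₀ hB₃ hr hB hκE hL Ec ι Φ U hU hrU
      hEhol hΦemb hΦsp w hw₀ hw htail)
    hℓκ hdom

/-! ## §2 The N22 PIN FACE, every run length, at a reading pinned to the kernel objects of record -/

open Classical in
/-- ★★★ **THE N22 PIN FACE FROM OUTPUT-LEVEL COUPLING LETTERS** — `N22At (rateCarriersOfRecord₁₃CoPH 𝔯 F θ hP g₀ os k).u3` for EVERY `k` under `hpin` (K3⁷ v5's `U3PinnedKernels` at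
the tuple): `ne9_EA_objectsOfRecord₁₃_of_outputCoordLetters` fed to dag-n22-w3's `n22At_rateCarriers_of_kernels_pin_of_ne9`.  THE N22 ROW SENTENCE in print-level currency.  LOCATED
(hypothesis form); N22 NOT discharged. -/
theorem n22At_rateCarriers_of_kernels_pin_of_outputCoordLetters (𝔯 : RateReading₁₃CoPH N) (θ : Stage13HParams F N) (hP : θ.Provisos₁₃CoPH F N)
    (g₀ : ℕ → ℝ) (os : List (ULoop F)) (ℓ : U3Letters₁₁) (hs : ℓ.Signs) (hpin : (𝔯.lit F θ hP g₀ os).u3 = objectsOfRecord₁₃ F N θ.toStage13Params ℓ)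
    (hlim : PolLimitsExistOfRecord₁₃ F N θ.toStage13Params) {𝔸 : Type*} (m' : ℕ) (M : ℕ) [NeZero M] (hM : M = F.L ^ m')
    (S : (K : ℕ) → ClusterTower (F.P K) 𝔸 M) (emb : ReadingMaps F (MatA N) 𝔸) (hloc : Localizes17OfRecord₁₃ F N θ.toStage13Params S emb)
    (sp : (K k : ℕ) → (domSys (F.P K) M (k + 1)).Dom → Set (CPair (F.P K) 𝔸))
    {κ δ₀ B₃ r : ℝ} (Λt : ℕ → ℕ → ℝ) (hΛt : ∀ n i, 0 ≤ Λt n i)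
    (hκ₀ : kappa₀ (4 * 2 ^ 4) (2 * 4) ≤ κ / 2) (hδ₀ : 0 < δ₀) (hB₃ : 0 ≤ B₃) (hr : 0 < r)
    (hlet : ∀ (K k : ℕ), ∀ g ∈ box θ.γ k, ∀ (i : Fin (k + 1)), ∀ t ∈ Ioc (0 : ℝ) θ.γ, ∀ (X : (domSys (F.P K) M (k + 1)).Dom), ∀ φ ∈ sp K k X,
      ‖((S K) k).E g φ X - ((S K) k).E (Function.update g i t) φ X‖ ≤ Λt (k + 1) i * Real.exp (-(κ * (domSys (F.P K) M (k + 1)).dj X)) * |g i - t|)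
    (Ec : ℕ → ℕ → Type*) [∀ K k, NormedAddCommGroup (Ec K k)] [∀ K k, NormedSpace ℂ (Ec K k)]
    (ι : letI := θ.instVβ₁; letI := θ.instVβ₂
      (K k : ℕ) → (domSys (F.P K) M (k + 1)).Dom → ((Fin (F.P K).d → Site (F.P K) (k + 1) → θ.Vβ) →L[ℝ] Ec K k))
    (Φ : (K k : ℕ) → (domSys (F.P K) M (k + 1)).Dom → Ec K k → CPair (F.P K) 𝔸)
    (U : (K k : ℕ) → (domSys (F.P K) M (k + 1)).Dom → Set (Ec K k)) (hU : ∀ K k X, IsOpen (U K k X)) (hrU : ∀ K k X, ball (0 : Ec K k) r ⊆ U K k X)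
    (hEhol : ∀ g ∈ Window θ.γ, ∀ (K k : ℕ) (X : (domSys (F.P K) M (k + 1)).Dom),
      DifferentiableOn ℂ (fun z => ((S K) k).E (histPrefix g k) (Φ K k X z) X) (U K k X))
    (hΦemb : letI := θ.instVβ₁; letI := θ.instVβ₂
      ∀ (K k : ℕ) (X : (domSys (F.P K) M (k + 1)).Dom) (B : Fin (F.P K).d → Site (F.P K) (k + 1) → θ.Vβ),
        Φ K k X (ι K k X B) = emb K k (fun l t => NormedSpace.exp (θ.ρ8 (B l t))))
    (hΦsp : ∀ (K k : ℕ) (X : (domSys (F.P K) M (k + 1)).Dom), ∀ z ∈ ball (0 : Ec K k) r, Φ K k X z ∈ sp K k X)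
    (w : (K k : ℕ) → (domSys (F.P K) M (k + 1)).Dom → Site (F.P K) (k + 1) → ℝ) (hw₀ : ∀ K k X t, 0 ≤ w K k X t)
    (hw : letI := θ.instVβ₁; letI := θ.instVβ₂; letI := θ.instιβ
      ∀ (K k : ℕ) (X : (domSys (F.P K) M (k + 1)).Dom) (l : Fin (F.P K).d) (t : Site (F.P K) (k + 1)) (c : θ.ιβ),
        ‖ι K k X (Pi.single l (Pi.single t (θ.bV c)))‖ ≤ w K k X t)
    (htail : ∀ (K k : ℕ) (X : (domSys (F.P K) M (k + 1)).Dom) (t : Site (F.P K) (k + 1)),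
      let e : Site (F.P K) (k + 1) → TPt 4 (domCount (F.P K) M (k + 1) * M) := fun x i => (ZMod.cast (x i) : ZMod (domCount (F.P K) M (k + 1) * M))
      w K k X t ≤ B₃ * Real.exp (-δ₀ * distCT (domCount (F.P K) M (k + 1)) M (e t) (nearT (M := M) (e t) X)))
    (hℓκ : ℓ.κ ≤ delta1 δ₀ κ ((M : ℝ) * 4))
    (hdom : ∀ n i, 16 * B₃ ^ 2 / r ^ 2 * Real.exp (delta1 δ₀ κ ((M : ℝ) * 4) * ((M : ℝ) * 4) * 3) * K₀ (4 * 2 ^ 4) (2 * 4) * K₁ 4 (δ₀ / 2) * Λt n i ≤ ℓ.moduli n i) (k : ℕ) :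
    N22At (rateCarriersOfRecord₁₃CoPH 𝔯 F θ hP g₀ os k).u3 :=
  n22At_rateCarriers_of_kernels_pin_of_ne9 𝔯 θ hP g₀ os ℓ hs hpin
    (ne9_EA_objectsOfRecord₁₃_of_outputCoordLetters F N θ.toStage13Params ℓ hs hlim m' M hM S emb hloc sp Λt hΛt hκ₀ hδ₀ hB₃ hr hlet Ec ι Φ U hU hrU hEhol
      hΦemb hΦsp w hw₀ hw htail hℓκ hdom) k

open Classical in
/-- ★★★ **THE N22 PIN FACE FROM OUTPUT-LEVEL COUPLING HOLOMORPHY ON UNIFORM MARGINS**, every run length `k`, under `hpin` — `ne9_EA_objectsOfRecord₁₃_of_outputCoordHolo` fed to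
dag-n22-w3's `n22At_rateCarriers_of_kernels_pin_of_ne9`.  LOCATED (hypothesis form); N22 NOT discharged. -/
theorem n22At_rateCarriers_of_kernels_pin_of_outputCoordHolo (𝔯 : RateReading₁₃CoPH N) (θ : Stage13HParams F N) (hP : θ.Provisos₁₃CoPH F N)
    (g₀ : ℕ → ℝ) (os : List (ULoop F)) (ℓ : U3Letters₁₁) (hs : ℓ.Signs) (hpin : (𝔯.lit F θ hP g₀ os).u3 = objectsOfRecord₁₃ F N θ.toStage13Params ℓ)
    (hlim : PolLimitsExistOfRecord₁₃ F N θ.toStage13Params) {𝔸 : Type*} (m' : ℕ) (M : ℕ) [NeZero M] (hM : M = F.L ^ m')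
    (S : (K : ℕ) → ClusterTower (F.P K) 𝔸 M) (emb : ReadingMaps F (MatA N) 𝔸) (hloc : Localizes17OfRecord₁₃ F N θ.toStage13Params S emb)
    (sp : (K k : ℕ) → (domSys (F.P K) M (k + 1)).Dom → Set (CPair (F.P K) 𝔸))
    {κ κE δ₀ B₃ r B : ℝ} (ρt : ℕ → ℕ → ℝ) (hρt : ∀ n i, 0 < ρt n i)
    (hκ₀ : kappa₀ (4 * 2 ^ 4) (2 * 4) ≤ κ / 2) (hδ₀ : 0 < δ₀) (hB₃ : 0 ≤ B₃) (hr : 0 < r) (hB : 0 ≤ B) (hκE : κ ≤ κE)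
    (hL : ∀ (K k : ℕ) (i : Fin (k + 1)), ∀ g ∈ box θ.γ k, ∀ (X : (domSys (F.P K) M (k + 1)).Dom), ∀ φ ∈ sp K k X,
      ∃ (Ec : ℂ → ℂ) (O : Set ℂ), DifferentiableOn ℂ Ec O ∧ (∀ t ∈ Ioc (0 : ℝ) θ.γ, closedBall (t : ℂ) (ρt (k + 1) i) ⊆ O) ∧
        (∀ z ∈ O, ‖Ec z‖ ≤ B * Real.exp (-(κE * (domSys (F.P K) M (k + 1)).dj X))) ∧
        (∀ t ∈ Ioc (0 : ℝ) θ.γ, Ec t = ((S K) k).E (Function.update g i t) φ X))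
    (Ec : ℕ → ℕ → Type*) [∀ K k, NormedAddCommGroup (Ec K k)] [∀ K k, NormedSpace ℂ (Ec K k)]
    (ι : letI := θ.instVβ₁; letI := θ.instVβ₂
      (K k : ℕ) → (domSys (F.P K) M (k + 1)).Dom → ((Fin (F.P K).d → Site (F.P K) (k + 1) → θ.Vβ) →L[ℝ] Ec K k))
    (Φ : (K k : ℕ) → (domSys (F.P K) M (k + 1)).Dom → Ec K k → CPair (F.P K) 𝔸)
    (U : (K k : ℕ) → (domSys (F.P K) M (k + 1)).Dom → Set (Ec K k)) (hU : ∀ K k X, IsOpen (U K k X)) (hrU : ∀ K k X, ball (0 : Ec K k) r ⊆ U K k X)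
    (hEhol : ∀ g ∈ Window θ.γ, ∀ (K k : ℕ) (X : (domSys (F.P K) M (k + 1)).Dom),
      DifferentiableOn ℂ (fun z => ((S K) k).E (histPrefix g k) (Φ K k X z) X) (U K k X))
    (hΦemb : letI := θ.instVβ₁; letI := θ.instVβ₂
      ∀ (K k : ℕ) (X : (domSys (F.P K) M (k + 1)).Dom) (B : Fin (F.P K).d → Site (F.P K) (k + 1) → θ.Vβ),
        Φ K k X (ι K k X B) = emb K k (fun l t => NormedSpace.exp (θ.ρ8 (B l t))))
    (hΦsp : ∀ (K k : ℕ) (X : (domSys (F.P K) M (k + 1)).Dom), ∀ z ∈ ball (0 : Ec K k) r, Φ K k X z ∈ sp K k X)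
    (w : (K k : ℕ) → (domSys (F.P K) M (k + 1)).Dom → Site (F.P K) (k + 1) → ℝ) (hw₀ : ∀ K k X t, 0 ≤ w K k X t)
    (hw : letI := θ.instVβ₁; letI := θ.instVβ₂; letI := θ.instιβ
      ∀ (K k : ℕ) (X : (domSys (F.P K) M (k + 1)).Dom) (l : Fin (F.P K).d) (t : Site (F.P K) (k + 1)) (c : θ.ιβ),
        ‖ι K k X (Pi.single l (Pi.single t (θ.bV c)))‖ ≤ w K k X t)
    (htail : ∀ (K k : ℕ) (X : (domSys (F.P K) M (k + 1)).Dom) (t : Site (F.P K) (k + 1)),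
      let e : Site (F.P K) (k + 1) → TPt 4 (domCount (F.P K) M (k + 1) * M) := fun x i => (ZMod.cast (x i) : ZMod (domCount (F.P K) M (k + 1) * M))
      w K k X t ≤ B₃ * Real.exp (-δ₀ * distCT (domCount (F.P K) M (k + 1)) M (e t) (nearT (M := M) (e t) X)))
    (hℓκ : ℓ.κ ≤ delta1 δ₀ κ ((M : ℝ) * 4))
    (hdom : ∀ n i, 16 * B₃ ^ 2 / r ^ 2 * Real.exp (delta1 δ₀ κ ((M : ℝ) * 4) * ((M : ℝ) * 4) * 3) * K₀ (4 * 2 ^ 4) (2 * 4) * K₁ 4 (δ₀ / 2) *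
        (4 * B / ρt n i) ≤ ℓ.moduli n i) (k : ℕ) :
    N22At (rateCarriersOfRecord₁₃CoPH 𝔯 F θ hP g₀ os k).u3 :=
  n22At_rateCarriers_of_kernels_pin_of_ne9 𝔯 θ hP g₀ os ℓ hs hpin
    (ne9_EA_objectsOfRecord₁₃_of_outputCoordHolo F N θ.toStage13Params ℓ hs hlim m' M hM S emb hloc sp ρt hρt hκ₀ hδ₀ hB₃ hr hB hκE hL Ec ι Φ U hU hrU hEhol
      hΦemb hΦsp w hw₀ hw htail hℓκ hdom) k

end YMDAG.N22.AtRecordOfPrintedSlots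

end
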